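import Mathlib.RingTheory.AlgebraicIndependent.Adjoin
import Literature.AnabelianGeometry.AbsoluteAnabelian.AbsTopIII.KummerFaithfulPurelyTranscendentalProofs
import HarnessLib

/-!
# [AbsTopIII] Rmk. 1.5.4 (iii): a finite extension of `k(z_I)` is purely transcendental over a finitely generated subfield

Proof-only companion (no new definitions; Mathlib field theory only) to `AbsTopIII/KummerFaithful.lean`
(S. Mochizuki, *Topics in Absolute Anabelian Geometry III*, §1, Rmk. 1.5.4 (iii) p. 34, the printed
parenthesis: "any finitely generated extension of `k` is contained in a finitely generated extension of
some `ℚ_p(x_i)_{i ∈ J}` for `J ⊆ I` finite, over which `k` is purely transcendental").  The torus file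
`KummerFaithfulPurelyTranscendentalProofs` runs this argument INSIDE the proof of
`divisibleElementsTrivial_units_of_finite_adjoin_algebraicIndependent`; here it is extracted as a
stand-alone DECOMPOSITION LEMMA (junction «K-dec» of the F-0371 route of the cell abc-iut), in the shape
consumed by the abelian-variety bricks `AbelianVariety.exists_finset_intermediateField_descent`
(`Motives/AbelianVarietyFGSubfieldDescent`) and
`divisibleElementsTrivial_points_of_iso_baseChange` (`KummerFaithfulPurelyTranscendentalAbelianProofs`):

* `exists_fg_intermediateField_purelyTranscendental` — for `E` finite over `k(z_I)` (`z` algebraically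
  independent over `k`, any index type) and any finite `T ⊆ E` there are a finite set of indices `s` and
  an intermediate field `E_J = k(z_s)(b)` (`b` a `k(z_I)`-basis of `E`) with `T ⊆ E_J`, `E_J` finitely
  generated over `k`, the remaining variables `z_{I ∖ s}` ALGEBRAICALLY INDEPENDENT over `E_J`, and
  `E = E_J(z_{I ∖ s})`;
* `exists_fg_intermediateField_isFractionRing_mvPolynomial` — the same packaged as an
  `IsFractionRing (MvPolynomial ↥sᶜ E_J) E` structure compatible with `E_J ⊆ E`
  (`AlgebraicIndependent.aevalEquivField`).

Classical field theory; nothing here bears on [IUTchIII] Cor. 3.12; typed ≠ discharged.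
-/

noncomputable section

open scoped Classical Polynomial
open Polynomial

namespace Literature.AnabelianGeometry.AbsoluteAnabelian.AbsTopIII

universe u v

section Decomposition

variable {k E : Type u} [Field k] [Field E] [Algebra k E]

/-- A nonzero polynomial with coefficients in an intermediate field `F` annihilating an element
algebraic over `F` (the minimal polynomial, coerced to `E[X]`). Routine. [cite: MochizukiAbsTopIII2015, Rmk 1.5.4 (iii) p.34] -/
private theorem exists_poly_of_isAlgebraic'' (F : IntermediateField k E) {a : E}
    (ha : IsAlgebraic F a) : ∃ P : E[X], P ≠ 0 ∧ (∀ n, P.coeff n ∈ F) ∧ P.IsRoot a := by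
  obtain ⟨Q, hQ0, hQa⟩ := ha
  refine ⟨Q.map (algebraMap F E), (Polynomial.map_ne_zero_iff (algebraMap F E).injective).mpr hQ0,
    fun n => ?_, ?_⟩
  · rw [Polynomial.coeff_map]; exact (Q.coeff n).2
  · rw [Polynomial.IsRoot, Polynomial.eval_map, ← Polynomial.aeval_def]; exact hQa

/-- Conversely, a root of a nonzero polynomial with coefficients in `F` is algebraic over `F`.
Routine. [cite: MochizukiAbsTopIII2015, Rmk 1.5.4 (iii) p.34] -/
private theorem isAlgebraic_of_poly'' (F : IntermediateField k E) {a : E} (P : E[X]) (hP0 : P ≠ 0)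
    (hP : ∀ n, P.coeff n ∈ F) (ha : P.IsRoot a) : IsAlgebraic F a := by
  let Q : F[X] := ∑ n ∈ P.support, Polynomial.monomial n (⟨P.coeff n, hP n⟩ : F)
  have hQ : Q.map (algebraMap F E) = P := by
    simp only [Q, Polynomial.map_sum, Polynomial.map_monomial]
    exact P.as_sum_support.symm
  refine ⟨Q, fun h => hP0 (by rw [← hQ, h, Polynomial.map_zero]), ?_⟩
  rw [Polynomial.aeval_def, ← Polynomial.eval_map, hQ]
  exact ha

/-- **Decomposition lemma** (the parenthesis of [AbsTopIII] Rmk. 1.5.4 (iii) p. 34, for a general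
ground field `k`): let `E ⊇ k` be FINITE over `k(z_i)_{i ∈ I}` for a family `z` algebraically
independent over `k` (any index type), and let `T ⊆ E` be finite.  Then there are a FINITE set of
indices `s ⊆ I` and an intermediate field `E_J` (namely `k(z_s)(b)`, `b` a `k(z_I)`-basis of `E`)
such that `T ⊆ E_J`, `E_J` is finitely generated over `k`, the remaining variables `(z_i)_{i ∉ s}` are
algebraically independent over `E_J`, and they generate `E` over `E_J`: `E = E_J(z_{I ∖ s})` is PURELY
TRANSCENDENTAL over `E_J`.  (Extracted from the proof of
`divisibleElementsTrivial_units_of_finite_adjoin_algebraicIndependent`, with "the coordinates of `u`"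
replaced by the finite set `T`.) [cite: MochizukiAbsTopIII2015, Rmk 1.5.4 (iii) p.34] -/
theorem exists_fg_intermediateField_purelyTranscendental {I : Type v} (z : I → E)
    (hz : AlgebraicIndependent k z) [Module.Finite (IntermediateField.adjoin k (Set.range z)) E]
    (T : Finset E) :
    ∃ (s : Set I) (EJ : IntermediateField k E), s.Finite ∧ (↑T : Set E) ⊆ EJ ∧ EJ.FG ∧
      AlgebraicIndependent EJ (fun i : ↥sᶜ => z i) ∧
        IntermediateField.adjoin EJ (Set.range fun i : ↥sᶜ => z i) = ⊤ := by
  classical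
  set FI : IntermediateField k E := IntermediateField.adjoin k (Set.range z) with hFI
  -- a basis of `E` over `FI = k(z_I)`; algebraic equations of its members; coordinates of `T`
  let b := Module.finBasis FI E
  have hbalg : ∀ m, ∃ P : E[X], P ≠ 0 ∧ (∀ n, P.coeff n ∈ FI) ∧ P.IsRoot (b m) := fun m =>
    exists_poly_of_isAlgebraic'' FI (Algebra.IsAlgebraic.isAlgebraic (b m))
  choose P hP0 hPcoef hProot using hbalg
  have hT₁ : ∀ m n, ∃ T₁ : Finset E, (T₁ : Set E) ⊆ Set.range z ∧
      (P m).coeff n ∈ IntermediateField.adjoin k (T₁ : Set E) := fun m n =>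
    IntermediateField.exists_finset_of_mem_adjoin (hPcoef m n)
  choose T₁ hT₁sub hT₁mem using hT₁
  have hT' : ∀ (t : E) (m), ∃ T' : Finset E, (T' : Set E) ⊆ Set.range z ∧
      ((b.repr t m : FI) : E) ∈ IntermediateField.adjoin k (T' : Set E) := fun t m =>
    IntermediateField.exists_finset_of_mem_adjoin (b.repr t m).2
  choose T' hT'sub hT'mem using hT'
  -- the finitely many variables involved
  let S₀ : Finset E :=
    (Finset.univ.biUnion fun m => (P m).support.biUnion (T₁ m)) ∪
      (T.biUnion fun t => Finset.univ.biUnion fun m => T' t m)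
  have hS₀sub : (S₀ : Set E) ⊆ Set.range z := by
    intro e he
    rw [Finset.mem_coe] at he
    rcases Finset.mem_union.mp he with h | h
    · obtain ⟨m, -, hm⟩ := Finset.mem_biUnion.mp h
      obtain ⟨n, -, hn⟩ := Finset.mem_biUnion.mp hm
      exact hT₁sub m n hn
    · obtain ⟨t, -, ht⟩ := Finset.mem_biUnion.mp h
      obtain ⟨m, -, hm⟩ := Finset.mem_biUnion.mp ht
      exact hT'sub t m hm
  have hTS : ∀ m, ∀ n ∈ (P m).support, (T₁ m n : Set E) ⊆ S₀ := fun m n hn e he => by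
    rw [Finset.mem_coe] at he ⊢
    exact Finset.mem_union_left _ (Finset.mem_biUnion.mpr
      ⟨m, Finset.mem_univ m, Finset.mem_biUnion.mpr ⟨n, hn, he⟩⟩)
  have hT'S : ∀ t ∈ T, ∀ m, (T' t m : Set E) ⊆ S₀ := fun t ht m e he => by
    rw [Finset.mem_coe] at he ⊢
    exact Finset.mem_union_right _ (Finset.mem_biUnion.mpr
      ⟨t, ht, Finset.mem_biUnion.mpr ⟨m, Finset.mem_univ m, he⟩⟩)
  -- the finite set of indices `s` ("`J`") and the field `FJ = k(z_J)`
  let s : Set I := z ⁻¹' (S₀ : Set E)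
  have hzs : z '' s = (S₀ : Set E) := Set.image_preimage_eq_of_subset hS₀sub
  have hsfin : s.Finite := Set.Finite.preimage hz.injective.injOn S₀.finite_toSet
  set FJ : IntermediateField k E := IntermediateField.adjoin k (z '' s) with hFJ
  have hmemFJ : ∀ {X : Finset E}, (X : Set E) ⊆ S₀ → ∀ {e : E},
      e ∈ IntermediateField.adjoin k (X : Set E) → e ∈ FJ := fun hX e he => by
    rw [hFJ, hzs]
    exact IntermediateField.adjoin.mono k _ _ hX he
  have hPcoefJ : ∀ m n, (P m).coeff n ∈ FJ := by
    intro m n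
    by_cases hn : n ∈ (P m).support
    · exact hmemFJ (hTS m n hn) (hT₁mem m n)
    · rw [Polynomial.notMem_support_iff.mp hn]
      exact zero_mem _
  have hreprJ : ∀ t ∈ T, ∀ m, ((b.repr t m : FI) : E) ∈ FJ := fun t ht m =>
    hmemFJ (hT'S t ht m) (hT'mem t m)
  have hbalgJ : ∀ m, IsAlgebraic FJ (b m) := fun m =>
    isAlgebraic_of_poly'' FJ (P m) (hP0 m) (hPcoefJ m) (hProot m)
  -- the field `EJ = k(z_J)(b)`, as an intermediate field of `E/k`
  set EJ : IntermediateField k E :=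
    (IntermediateField.adjoin FJ (Set.range b)).restrictScalars k with hEJ
  have hFJ_EJ : FJ ≤ EJ := fun e he =>
    (IntermediateField.adjoin FJ (Set.range b)).algebraMap_mem ⟨e, he⟩
  have hb_EJ : ∀ m, b m ∈ EJ := fun m =>
    IntermediateField.subset_adjoin FJ (Set.range b) ⟨m, rfl⟩
  have hT_EJ : (↑T : Set E) ⊆ EJ := by
    intro t ht
    rw [Finset.mem_coe] at ht
    rw [SetLike.mem_coe, ← b.sum_repr t]
    refine sum_mem fun m _ => ?_
    rw [Algebra.smul_def]
    exact mul_mem (hFJ_EJ (hreprJ t ht m)) (hb_EJ m)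
  -- `EJ` is algebraic over `FJ`
  letI : Algebra FJ EJ := (IntermediateField.inclusion hFJ_EJ).toRingHom.toAlgebra
  haveI : IsScalarTower FJ EJ E := IsScalarTower.of_algebraMap_eq (fun _ => rfl)
  haveI hEJalg₀ : Algebra.IsAlgebraic FJ (IntermediateField.adjoin FJ (Set.range b)) :=
    IntermediateField.isAlgebraic_adjoin (fun x hx => by
      obtain ⟨m, rfl⟩ := hx
      exact (hbalgJ m).isIntegral)
  haveI : Algebra.IsAlgebraic FJ EJ := ⟨fun y => by
    have hy : (y : E) ∈ IntermediateField.adjoin FJ (Set.range b) := y.2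
    have hyE : IsAlgebraic FJ (y : E) :=
      (isAlgebraic_algHom_iff (IntermediateField.adjoin FJ (Set.range b)).val
        Subtype.val_injective).mpr (hEJalg₀.isAlgebraic ⟨(y : E), hy⟩)
    exact (isAlgebraic_algHom_iff (IsScalarTower.toAlgHom FJ EJ E) Subtype.val_injective).mp hyE⟩
  -- the remaining variables are algebraically independent over `EJ` ...
  have hzT : AlgebraicIndependent EJ (fun i : ↥sᶜ => z i) := by
    have h1 : AlgebraicIndependent (Algebra.adjoin k (z '' s)) (fun i : ↥sᶜ => z i) :=
      hz.adjoin_of_disjoint disjoint_compl_right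
    have h2 : AlgebraicIndependent FJ (fun i : ↥sᶜ => z i) :=
      IntermediateField.algebraicIndependent_adjoin_iff.mpr h1
    exact h2.extendScalars EJ
  -- ... and generate `E` over `EJ`
  have htop : IntermediateField.adjoin EJ (Set.range fun i : ↥sᶜ => z i) = ⊤ := by
    rw [eq_top_iff]
    intro e _
    rw [← b.sum_repr e]
    refine sum_mem fun m _ => ?_
    rw [Algebra.smul_def]
    refine mul_mem ?_ ((IntermediateField.adjoin EJ _).algebraMap_mem ⟨b m, hb_EJ m⟩)
    have hFI_le : FI ≤ (IntermediateField.adjoin EJ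
        (Set.range fun i : ↥sᶜ => z i)).restrictScalars k := by
      rw [hFI]
      refine IntermediateField.adjoin_le_iff.mpr ?_
      rintro _ ⟨i, rfl⟩
      by_cases hi : i ∈ s
      · have hzi : z i ∈ EJ := hFJ_EJ (IntermediateField.subset_adjoin k (z '' s) ⟨i, hi, rfl⟩)
        exact (IntermediateField.adjoin EJ _).algebraMap_mem ⟨z i, hzi⟩
      · exact IntermediateField.subset_adjoin EJ _ ⟨⟨i, hi⟩, rfl⟩
    exact hFI_le (b.repr e m).2
  -- `EJ` is finitely generated over `k`
  have hEJ_eq : EJ = IntermediateField.adjoin k (z '' s ∪ Set.range b) :=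
    IntermediateField.adjoin_adjoin_left k (z '' s) (Set.range b)
  have hEJ_fg : EJ.FG := by
    rw [hEJ_eq]
    refine IntermediateField.fg_adjoin_of_finite (Set.Finite.union ?_ (Set.finite_range _))
    rw [hzs]
    exact S₀.finite_toSet
  exact ⟨s, EJ, hsfin, hT_EJ, hEJ_fg, hzT, htop⟩

/-- **Decomposition lemma, `IsFractionRing` packaging**: under the hypotheses of
`exists_fg_intermediateField_purelyTranscendental`, for every finite `T ⊆ E` there are a finite set
of indices `s` and a finitely generated intermediate field `E_J ⊇ T` together with an
`MvPolynomial ↥sᶜ E_J`-algebra structure on `E`, compatible with `E_J ⊆ E`, for which `E` is THE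
FRACTION FIELD of the polynomial ring `E_J[z_i]_{i ∉ s}` — `E = E_J(z_{I ∖ s})` purely transcendental
(`AlgebraicIndependent.aevalEquivField`).  This is the input shape of
`divisibleElementsTrivial_points_of_iso_baseChange` / `AbelianVariety.algPoints_const_of_isFractionRing_mvPolynomial_index`.
[cite: MochizukiAbsTopIII2015, Rmk 1.5.4 (iii) p.34] -/
theorem exists_fg_intermediateField_isFractionRing_mvPolynomial {I : Type v} (z : I → E)
    (hz : AlgebraicIndependent k z) [Module.Finite (IntermediateField.adjoin k (Set.range z)) E]
    (T : Finset E) :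
    ∃ (s : Set I) (EJ : IntermediateField k E) (_ : Algebra (MvPolynomial ↥sᶜ EJ) E)
      (_ : IsScalarTower EJ (MvPolynomial ↥sᶜ EJ) E) (_ : IsFractionRing (MvPolynomial ↥sᶜ EJ) E),
      s.Finite ∧ (↑T : Set E) ⊆ EJ ∧ EJ.FG ∧
        ∀ i : ↥sᶜ, algebraMap (MvPolynomial ↥sᶜ EJ) E (MvPolynomial.X i) = z i := by
  obtain ⟨s, EJ, hsfin, hT, hFG, hzT, htop⟩ :=
    exists_fg_intermediateField_purelyTranscendental z hz T
  -- `E ≅ Frac EJ[z_{sᶜ}]` over `EJ`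
  let e : FractionRing (MvPolynomial ↥sᶜ EJ) ≃ₐ[EJ] E :=
    hzT.aevalEquivField.trans
      ((IntermediateField.equivOfEq htop).trans IntermediateField.topEquiv)
  letI alg : Algebra (MvPolynomial ↥sᶜ EJ) E :=
    ((e : FractionRing (MvPolynomial ↥sᶜ EJ) →+* E).comp
      (algebraMap (MvPolynomial ↥sᶜ EJ) (FractionRing (MvPolynomial ↥sᶜ EJ)))).toAlgebra
  haveI hT₁ : IsScalarTower EJ (MvPolynomial ↥sᶜ EJ) E := by
    refine IsScalarTower.of_algebraMap_eq fun c => ?_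
    change algebraMap EJ E c = e (algebraMap (MvPolynomial ↥sᶜ EJ) _ (algebraMap EJ _ c))
    rw [← IsScalarTower.algebraMap_apply, AlgEquiv.commutes]
  -- `e` is an isomorphism of `MvPolynomial`-algebras, so `E` is a fraction field too
  let e' : FractionRing (MvPolynomial ↥sᶜ EJ) ≃ₐ[MvPolynomial ↥sᶜ EJ] E :=
    { e with commutes' := fun _ => rfl }
  haveI hF : IsFractionRing (MvPolynomial ↥sᶜ EJ) E :=
    IsLocalization.isLocalization_of_algEquiv (nonZeroDivisors (MvPolynomial ↥sᶜ EJ)) e'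
  refine ⟨s, EJ, alg, hT₁, hF, hsfin, hT, hFG, fun i => ?_⟩
  change ((hzT.aevalEquivField (algebraMap (MvPolynomial ↥sᶜ EJ)
    (FractionRing (MvPolynomial ↥sᶜ EJ)) (MvPolynomial.X i)) : IntermediateField.adjoin EJ _) : E) =
    z i
  rw [hzT.aevalEquivField_algebraMap_apply_coe, MvPolynomial.aeval_X]

end Decomposition

end Literature.AnabelianGeometry.AbsoluteAnabelian.AbsTopIII

end
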